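import Summits.ValiantsHypothesis.ValiantsHypothesis.Theorems.FreeEnergyLiftMonotoneToLiftSound
import Summits.ValiantsHypothesis.ValiantsHypothesis.Theses.FreeEnergyLift -- buildfix (bf3-g25): explicit route import (the 03:03:44 re-land of …MonotoneToLiftProgram dropped it upstream; this LEAF closer is where it belongs)

/-!
# Route `FreeEnergyLift`, item `MonotoneToLift` (stmt-ValiantsHypothesis-5606) — part 3/3:
# a monotone computation yields an exponential-cone lift of the free-energy epigraph

`monotoneToLift_proof : …Theses.FreeEnergyLift.MonotoneToLift` — the geometric-programming
dictionary (folklore; cf. the exponential-cone formulations of geometric programs): if `P` is a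
Jerrum–Snir monotone computation of `f` over `ℝ≥0` (`IsMonotoneComputation P f`: fan-in two,
plain sum gates, `P` computes `f`), then the epigraph `{(u, t) | log f(e^u) ≤ t}` of the free
energy of `f` is EXACTLY the projection of an affine slice of a product of
`3 · size(P) + 1 ≤ 8 · size(P) + 8` exponential cones
`K = {(w₁,w₂,w₃) | w₂ > 0, w₂ e^{w₁/w₂} ≤ w₃} ∪ {w₂ = 0, w₁ ≤ 0 ≤ w₃}` (no psd block).

## The cone program (part 1: `slot`, `Amap`, `bvec`)

Auxiliary variables `y ∈ ℝ^{3·size}`: `T_w = y_{3w}` (a log-upper bound for the value of gate `w`)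
and `Z_{w,1} = y_{3w+1}`, `Z_{w,2} = y_{3w+2}` (shares of the two operands of a sum gate). The
log-value form of an operand (`LOp`) is `u_i` for an input `X i`, `log c` for a constant `c`, and
`T_j` for a reference to gate `j`. Gate `w` contributes three constraints (`gateSlots`): all
trivial (`(0,0,0) ∈ K`) if the gate computes the zero polynomial (pruning; over `ℝ≥0` a gate value
vanishes at the positive point `e^u` iff it is the zero polynomial, `val_eq_zero_iff`); for a
product gate the linear inequality `Σ_o L(o) ≤ T_w` (as `(Σ L(o) - T_w, 0, 0) ∈ K`); for a sum
gate the two cone constraints `(L(oᵢ) - T_w, 1, Z_{w,i}) ∈ K`, i.e. `e^{L(oᵢ) - T_w} ≤ Z_{w,i}`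
(replaced by `0 ≤ Z_{w,i}` for an absent or zero operand) and the face inequality
`Z_{w,1} + Z_{w,2} ≤ 1`. The last constraint is `L(out) ≤ t` (or `0 ≤ t` if `f = 0`, matching
Mathlib's `Real.log 0 = 0`).

* Soundness (part 2, `sound`): feasible points bound `log f(e^u)` by `t`.
* Completeness (here, `complete`): the canonical point `T_w = log V_w(e^u)`,
  `Z_{w,i} = V_{oᵢ}(e^u) / V_w(e^u)` (`ystar`, part 1) satisfies every constraint, with equality
  where it matters, as soon as `log f(e^u) ≤ t`.

HONEST FRAMING: bookkeeping for a dormant route's dictionary item (the folklore dictionary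
between monotone arithmetic circuits and geometric-programming / exponential-cone lifts);
nothing here bears on `VP ≠ VNP`, which is NOT proved.
-/

noncomputable section

open MvPolynomial
open scoped NNReal

-- layout Summits/ValiantsHypothesis/ValiantsHypothesis forces the duplicated namespace component
set_option linter.dupNamespace false

namespace Summit.ValiantsHypothesis.ValiantsHypothesis.Theorems.FreeEnergyLift.MonotoneLift

open Literature.Computability.AlgebraicComplexity
open Literature.Barriers.ValiantsHypothesis
open ArithCircuit

/-! ### Completeness: the canonical point -/

section Complete

variable {σ : Type} [Fintype σ] (P : ArithCircuit ℝ≥0 σ)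

omit [Fintype σ] in
/-- The canonical log-variable of gate `w`. [folklore] -/
theorem Y_ystar_T (u : σ → ℝ) {w : ℕ} (hw : w < P.size) :
    AF.Y (ystar P u) (3 * w) = Real.log (val u (V P w)) := by
  rw [AF.Y_of_lt _ (by omega : 3 * w < 3 * P.size)]
  have h1 : (3 * w) % 3 = 0 := by omega
  have h2 : (3 * w) / 3 = w := by omega
  simp [ystar, h1, h2]

omit [Fintype σ] in
/-- The canonical share variables of gate `w`. [folklore] -/
theorem Y_ystar_Z (u : σ → ℝ) {w : ℕ} (hw : w < P.size) {i : ℕ} (hi : i < 2) :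
    AF.Y (ystar P u) (3 * w + 1 + i) = Zstar P u w i := by
  rw [AF.Y_of_lt _ (by omega : 3 * w + 1 + i < 3 * P.size)]
  have h1 : (3 * w + 1 + i) % 3 = 1 + i := by omega
  have h2 : (3 * w + 1 + i) / 3 = w := by omega
  simp [ystar, h1, h2]

/-- At the canonical point, a nonzero operand read inside gate `w` is EXACTLY the exponential of
its log-value form. [folklore] -/
theorem val_opVal_eq (u : σ → ℝ) (t : ℝ) {w : ℕ} (hw : w ≤ P.size)
    (o : Operand ℝ≥0 σ) (ho : opVal P w o ≠ 0) :
    val u (opVal P w o) = Real.exp ((LOp (3 * P.size) o).ev ((u, t), ystar P u)) := by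
  cases o with
  | var i => simp [LOp, opVal, Operand.eval]
  | const c =>
    have hc : (c : ℝ) ≠ 0 := by
      intro h
      apply ho
      simp only [opVal, Operand.eval, map_eq_zero_iff _ (C_injective σ ℝ≥0)]
      exact_mod_cast h
    have hcpos : 0 < (c : ℝ) := lt_of_le_of_ne c.2 (Ne.symm hc)
    simp [LOp, opVal, Operand.eval, Real.exp_log hcpos]
  | gate j =>
    rw [opVal_gate] at ho ⊢
    split_ifs at ho ⊢ with hj
    · simp only [LOp, AF.ev_yF]
      rw [Y_ystar_T P u (by omega), Real.exp_log (val_pos u ho)]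
    · exact absurd rfl ho

/-- **Completeness**: if `log P(e^u) ≤ t` then the canonical point is feasible. [folklore] -/
theorem complete (hfan : P.IsFanInTwo) (hplain : IsPlain P) (u : σ → ℝ) (t : ℝ)
    (ht : Real.log (val u P.eval) ≤ t) :
    ∀ c, slotPt (3 * P.size) (slot P (3 * P.size) c) ((u, t), ystar P u) ∈ expCone := by
  intro c
  unfold slot
  split_ifs with hc
  · -- a gate constraint
    set w := (c : ℕ) / 3 with hwdef
    set r : Fin 3 := ⟨(c : ℕ) % 3, Nat.mod_lt _ (by norm_num)⟩ with hrdef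
    unfold gateSlots
    split_ifs with hV
    · exact slotPt_triv_mem _ _
    have hg : P.gates[w]? = some P.gates[w] := List.getElem?_eq_getElem hc
    rw [hg]
    have hfan2 : (P.gates[w]).fanIn ≤ 2 := hfan _ (List.getElem_mem hc)
    have hT := Y_ystar_T P u hc
    have hVpos : 0 < val u (V P w) := val_pos u hV
    set g := P.gates[w] with hgdef
    cases hg' : g with
    | prod os =>
      rw [hg'] at hg hfan2
      simp only [gateSlotsOf]
      split_ifs with hr
      · simp only [slotPt, AF.ev_sub, AF.ev_yF, AF.ev_zero, mem_expCone_zero, le_refl, and_true,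
          hT]
        have hVw := V_prod P hg
        simp only [Gate.fanIn, Gate.args] at hfan2
        match os, hVw, hfan2 with
        | [], hVw, _ =>
          simp only [List.map_nil, List.prod_nil] at hVw
          simp [hVw, AF.lsum]
        | [o], hVw, _ =>
          simp only [List.map_cons, List.map_nil, List.prod_cons, List.prod_nil, mul_one] at hVw
          have ho : opVal P w o ≠ 0 := fun h => hV (by rw [hVw, h])
          simp only [List.map_cons, List.map_nil, AF.ev_lsum_cons, AF.ev_lsum_nil, add_zero]
          rw [hVw, val_opVal_eq P u t (le_of_lt hc) o ho, Real.log_exp, sub_self]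
        | [o₁, o₂], hVw, _ =>
          simp only [List.map_cons, List.map_nil, List.prod_cons, List.prod_nil, mul_one] at hVw
          have ho₁ : opVal P w o₁ ≠ 0 := fun h => hV (by rw [hVw, h, zero_mul])
          have ho₂ : opVal P w o₂ ≠ 0 := fun h => hV (by rw [hVw, h, mul_zero])
          simp only [List.map_cons, List.map_nil, AF.ev_lsum_cons, AF.ev_lsum_nil, add_zero]
          rw [hVw, map_mul, val_opVal_eq P u t (le_of_lt hc) o₁ ho₁,
            val_opVal_eq P u t (le_of_lt hc) o₂ ho₂, ← Real.exp_add, Real.log_exp, sub_self]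
        | _ :: _ :: _ :: _, _, hfan2 => simp at hfan2
      · exact slotPt_triv_mem _ _
    | sum args =>
      rw [hg'] at hg hfan2
      have hVw := V_sum P hplain hg
      simp only [Gate.fanIn, Gate.args, List.length_map] at hfan2
      have e1 : AF.Y (ystar P u) (3 * w + 1) = Zstar P u w 0 := by
        simpa using Y_ystar_Z P u hc (show 0 < 2 by norm_num)
      have e2 : AF.Y (ystar P u) (3 * w + 2) = Zstar P u w 1 := by
        simpa using Y_ystar_Z P u hc (show 1 < 2 by norm_num)
      simp only [gateSlotsOf]
      split_ifs with hr
      · -- the face inequality `Z₁ + Z₂ ≤ 1`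
        simp only [slotPt, AF.ev_sub, AF.ev_add, AF.ev_yF, AF.ev_const, AF.ev_zero,
          mem_expCone_zero, le_refl, and_true]
        rw [e1, e2]
        match args, hg, hVw, hfan2 with
        | [], _, hVw, _ =>
          simp only [List.map_nil, List.sum_nil] at hVw
          exact absurd hVw hV
        | [a], hg, hVw, _ =>
          simp only [List.map_cons, List.map_nil, List.sum_cons, List.sum_nil, add_zero] at hVw
          simp only [Zstar, hg, List.map_cons, List.map_nil, List.getElem?_cons_zero,
            List.getElem?_cons_succ, List.getElem?_nil]
          rw [← hVw, div_self hVpos.ne']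
          norm_num
        | [a, b], hg, hVw, _ =>
          simp only [List.map_cons, List.map_nil, List.sum_cons, List.sum_nil, add_zero] at hVw
          simp only [Zstar, hg, List.map_cons, List.map_nil, List.getElem?_cons_zero,
            List.getElem?_cons_succ]
          rw [← add_div, ← map_add, ← hVw, div_self hVpos.ne', sub_self]
        | _ :: _ :: _ :: _, _, _, hfan2 => simp at hfan2
      · -- an operand constraint
        have hr2 : (r : ℕ) - 1 < 2 := by have := r.2; omega
        have eZ := Y_ystar_Z P u hc hr2
        simp only [Zstar, hg] at eZ
        unfold sumSlot
        cases hoi : (args.map Prod.snd)[(r : ℕ) - 1]? with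
        | none =>
          simp only [hoi] at eZ
          simp only [slotPt, AF.ev_zero, AF.ev_yF, mem_expCone_zero, le_refl, true_and, eZ]
        | some o =>
          simp only [hoi] at eZ
          by_cases ho : opVal P w o = 0
          · simp only [ho, if_true, slotPt, AF.ev_zero, AF.ev_yF, mem_expCone_zero, le_refl,
              true_and, eZ, map_zero, zero_div]
          · simp only [ho, if_false, slotPt, AF.ev_sub, AF.ev_yF, mem_expCone_one, eZ, hT,
              Real.exp_sub, Real.exp_log hVpos, ← val_opVal_eq P u t (le_of_lt hc) o ho, le_refl]
  · -- the output constraint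
    unfold outSlot
    split_ifs with h0
    · simp only [slotPt, AF.ev_sub, AF.ev_zero, AF.ev_tF, mem_expCone_zero, le_refl, and_true]
      rw [h0, map_zero, Real.log_zero] at ht
      linarith
    · simp only [slotPt, AF.ev_sub, AF.ev_tF, AF.ev_zero, mem_expCone_zero, le_refl, and_true]
      have hne : opVal P P.size P.output ≠ 0 := by rwa [← eval_eq_opVal]
      have heq := val_opVal_eq P u t (w := P.size) le_rfl P.output hne
      rw [← eval_eq_opVal] at heq
      rw [heq, Real.log_exp] at ht
      linarith

end Complete

/-- **`MonotoneToLift`** (the geometric-programming dictionary): a Jerrum–Snir monotone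
computation `P` of `f` over `ℝ≥0` (fan-in two, plain sum gates) yields an exact lift of the
free-energy epigraph `{(u, t) | log f(e^u) ≤ t}` by `3 · size(P) + 1 ≤ 8 · size(P) + 8`
exponential cones (product gate: one linear inequality on the log-variables; sum gate: two
exponential cones and one face inequality; gates computing `0` are pruned) and no psd block.
[folklore] -/
theorem monotoneToLift_proof :
    Summit.ValiantsHypothesis.ValiantsHypothesis.Theses.FreeEnergyLift.MonotoneToLift := by
  unfold Summit.ValiantsHypothesis.ValiantsHypothesis.Theses.FreeEnergyLift.MonotoneToLift
  intro σ _ P f hP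
  obtain ⟨hfan, hplain, hcomp⟩ := hP
  have hf : f = P.eval := hcomp.symm
  subst hf
  refine ⟨3 * P.size + 1, 3 * P.size, Amap P (3 * P.size), bvec P (3 * P.size), by omega,
    fun u t => ?_⟩
  have key : ∀ y : Fin (3 * P.size) → ℝ, (∀ i, (Amap P (3 * P.size) ((u, t), y) +
      bvec P (3 * P.size)) i ∈ {w : ℝ × ℝ × ℝ | (0 < w.2.1 ∧ w.2.1 * Real.exp (w.1 / w.2.1) ≤ w.2.2) ∨
        (w.2.1 = 0 ∧ w.1 ≤ 0 ∧ 0 ≤ w.2.2)}) ↔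
      ∀ c, slotPt (3 * P.size) (slot P (3 * P.size) c) ((u, t), y) ∈ expCone := by
    intro y
    refine forall_congr' fun c => ?_
    rw [Amap_add_bvec_apply]
    rfl
  simp_rw [key]
  change Real.log (val u P.eval) ≤ t ↔ _
  exact ⟨fun ht => ⟨ystar P u, complete P hfan hplain u t ht⟩,
    fun ⟨y, hy⟩ => sound P hfan hplain u t y hy⟩

end Summit.ValiantsHypothesis.ValiantsHypothesis.Theorems.FreeEnergyLift.MonotoneLift
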